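import Mathlib.RepresentationTheory.FiniteIndex
import Mathlib.GroupTheory.DoubleCoset
import Literature.RepresentationTheory.Semisimple.Multiplicity
import Literature.RepresentationTheory.FiniteGroups.InducedRecognition
import HarnessLib

/-!
# Frobenius reciprocity and Mackey's formula for intertwining numbers of coinduced
# representations (the induction calculus of Barnet-Lamb–Gee–Geraghty–Taylor 2014, § 5.5)

Topic `Literature/RepresentationTheory/FiniteGroups` (finite-INDEX subgroups of an arbitrary
group, as in the sibling `InducedRecognition`; theorems and bookkeeping equivalences only, no
named fact).

Barnet-Lamb, Gee, Geraghty and Taylor (*Potential automorphy and change of weight*, Ann. of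
Math. 179 (2014), § 5.5 preamble = arXiv:1010.2561 § 5.4, pp. 38–39) record, for the
Grothendieck group of finite-dimensional representations of a group and `ind`/`res` along
finite-index subgroups, verbatim: "`(ind_{F'/F} A, B)_{F,l} = (A, res_{F'/F} B)_{F',l}`. (By
Frobenius reciprocity.)" and "`res_{F''/F} ∘ ind_{F'/F} = ∑_{[σ] ∈ G_{F'}\G_F/G_{F''}}
ind_{(σ⁻¹F').F''/F''} ∘ conj_σ ∘ res_{F'.(σF'')/F'}`. (By Mackey's formula.)", and combine them
into the intertwining-number formula used in the proof of Thm. 5.5.1 (ibid. p. 39, last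
display).  This file proves these statements for Mathlib's COINDUCED representations
`Representation.coind S.subtype σ` (the function model `{f : G → A | f (s x) = σ(s) f(x)}`,
`G` acting by right translation; for `[G : S] < ∞` it is isomorphic to `Representation.ind`,
Mathlib `Rep.indCoindIso`), with `( , ) = dim_k Hom` (`Representation.IntertwiningMap`):

* `Representation.IntertwiningMap.coindRightEquiv` / `indLeftEquiv` / `coindLeftEquiv` —
  **Frobenius reciprocity** as `k`-linear equivalences of `Hom` spaces: `Hom_G(τ, coind σ) ≃
  Hom_S(τ|_S, σ)`, `Hom_G(ind σ, τ) ≃ Hom_S(σ, τ|_S)`, and, for `[G : S] < ∞`,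
  `Hom_G(coind σ, τ) ≃ Hom_S(σ, τ|_S)` (Mathlib `Rep.resCoindHomEquiv`, `Rep.indResHomEquiv`,
  `Rep.indCoindIso`, unbundled through `Rep.homLinearEquiv`);
* `Representation.IntertwiningMap.piLeftLinearEquiv`, `finrank_intertwiningMap_pi_left` —
  `Hom_G(⊕ⱼ τⱼ, σ) ≃ Πⱼ Hom_G(τⱼ, σ)`;
* `mackeySubgroup S T g = T ∩ g⁻¹ S g` (a subgroup of `T`), `mackeyConjRep S T σ g = σ^g`
  (`x ↦ σ(g x g⁻¹)`), `mackeyPiece` (functions supported on the double coset `S g T`),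
  `mackeyPieceEquiv` — **Mackey, one double coset**: the piece supported on `S g T` is
  `T`-isomorphic to `coind_{T ∩ g⁻¹Sg}^T σ^g` via `f ↦ (t ↦ f(g t))`;
* `mackeyDecomposition` — **Mackey's decomposition** `(coind_S^G σ)|_T ≃ ⊕_{q ∈ S\G/T}` (piece
  on `S g_q T`), `g_q = q.out` (Mathlib `DoubleCoset.Quotient`), for `[G : S] < ∞`;
* `finite_doubleCosetQuotient`, `finiteDimensional_coindV` — `S\G/T` is finite and `coind_S^G σ`
  is finite-dimensional for `[G : S] < ∞`;
* `finrank_intertwiningMap_resCoind_right`, `finrank_intertwiningMap_resCoind_left`,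
  `finrank_intertwiningMap_coind_coind` — **Mackey's intertwining number theorem**:
  `dim Hom_G(coind_S σ, coind_T τ) = ∑_{q ∈ S\G/T} dim Hom_{T ∩ g_q⁻¹Sg_q}(σ^{g_q}, τ)`.

As in Mathlib's categorical statements, the field, the groups and the representation spaces are
taken in one universe.

## References

* T. Barnet-Lamb, T. Gee, D. Geraghty, R. Taylor, *Potential automorphy and change of weight*,
  Ann. of Math. 179 (2014), § 5.5 preamble (= arXiv:1010.2561 § 5.4, pp. 38–39).
  [BarnetlambEtAl2014]
* J.-P. Serre, *Linear Representations of Finite Groups*, GTM 42 (1977), § 7.2 (Frobenius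
  reciprocity), § 7.3 Prop. 22 (restriction of an induced representation to a subgroup:
  Mackey's decomposition). [SerreLinearRepresentations1977]
* T. Ceccherini-Silberstein, F. Scarabotti, F. Tolli, *Discrete Harmonic Analysis*,
  Cambridge Univ. Press (2018), Cor. 11.4.5 "Mackey's intertwining number theorem":
  `dim Hom_G(Ind_H^G ν, Ind_K^G σ) = ∑_{s ∈ 𝒮} dim Hom_{G_s}(Res^H_{G_s} ν, σ_s)` (finite groups;
  held text, PDF p. 327). [CeccherinisilbersteScarabottiTolli2018]
-/

noncomputable section

namespace Literature.RepresentationTheory.FiniteGroups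

open scoped MonoidAlgebra
open Literature.RepresentationTheory.Semisimple Module

universe u

/-! ### Frobenius reciprocity, as linear equivalences of `Hom_G` spaces

Mathlib's categorical adjunctions (`Rep.indResHomEquiv`, `Rep.resCoindHomEquiv`,
`Rep.coindResAdjunction`) unbundled to `Representation.IntertwiningMap`.  As in Mathlib, the
ring, the groups and the modules are taken in ONE universe `u` (the categorical statements need
the representation spaces to live in a universe at least that of the groups and of `k`). -/

section Frobenius

variable {k : Type u} [Field k] {G H : Type u} [Group G] [Group H] (φ : G →* H)
  {A : Type u} [AddCommGroup A] [Module k A] {B : Type u} [AddCommGroup B] [Module k B]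

/-- **Frobenius reciprocity for coinduction (right adjoint)**:
`Hom_H(τ, coind_φ σ) ≃ Hom_G(τ ∘ φ, σ)` (Mathlib `Rep.resCoindHomEquiv`, unbundled to
`Representation.IntertwiningMap`). [folklore] -/
def Representation.IntertwiningMap.coindRightEquiv (σ : Representation k G A)
    (τ : Representation k H B) :
    Representation.IntertwiningMap τ (Representation.coind φ σ) ≃ₗ[k]
      Representation.IntertwiningMap (τ.comp φ) σ :=
  (Rep.homLinearEquiv (Rep.of τ) (Rep.coind φ (Rep.of σ))).symm ≪≫ₗ
    (Rep.resCoindHomEquiv φ (Rep.of τ) (Rep.of σ)).symm ≪≫ₗ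
      Rep.homLinearEquiv (Rep.res φ (Rep.of τ)) (Rep.of σ)

/-- **Frobenius reciprocity for induction (left adjoint)**:
`Hom_H(ind_φ σ, τ) ≃ Hom_G(σ, τ ∘ φ)` (Mathlib `Rep.indResHomEquiv`, unbundled). [folklore] -/
def Representation.IntertwiningMap.indLeftEquiv (σ : Representation k G A)
    (τ : Representation k H B) :
    Representation.IntertwiningMap (Representation.ind φ σ) τ ≃ₗ[k]
      Representation.IntertwiningMap σ (τ.comp φ) :=
  (Rep.homLinearEquiv (Rep.ind φ (Rep.of σ)) (Rep.of τ)).symm ≪≫ₗ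
    Rep.indResHomEquiv φ (Rep.of σ) (Rep.of τ) ≪≫ₗ
      Rep.homLinearEquiv (Rep.of σ) (Rep.res φ (Rep.of τ))

end Frobenius

section FrobeniusFiniteIndex

variable {k : Type u} [Field k] {G : Type u} [Group G] (S : Subgroup G) [S.FiniteIndex]
  {A : Type u} [AddCommGroup A] [Module k A] {B : Type u} [AddCommGroup B] [Module k B]

open Classical in
/-- **Frobenius reciprocity for coinduction from a finite-index subgroup (left adjoint)**:
`Hom_G(coind_S σ, τ) ≃ Hom_S(σ, τ|_S)` (Mathlib `Rep.indCoindIso`: `ind_S ≅ coind_S` for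
`[G : S] < ∞`, and `Rep.indResHomEquiv`). [folklore] -/
def Representation.IntertwiningMap.coindLeftEquiv (σ : Representation k S A)
    (τ : Representation k G B) :
    Representation.IntertwiningMap (Representation.coind S.subtype σ) τ ≃ₗ[k]
      Representation.IntertwiningMap σ (τ.comp S.subtype) :=
  (Rep.homLinearEquiv (Rep.coind S.subtype (Rep.of σ)) (Rep.of τ)).symm ≪≫ₗ
    CategoryTheory.Linear.homCongr k (Rep.indCoindIso (Rep.of σ)).symm
      (CategoryTheory.Iso.refl (Rep.of τ)) ≪≫ₗ
    Rep.indResHomEquiv S.subtype (Rep.of σ) (Rep.of τ) ≪≫ₗ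
      Rep.homLinearEquiv (Rep.of σ) (Rep.res S.subtype (Rep.of τ))

end FrobeniusFiniteIndex


section PiLeft

variable {k : Type u} [Field k] {G : Type u} [Group G] {ι : Type*} [Fintype ι] [DecidableEq ι]
  {C : ι → Type u} [∀ j, AddCommGroup (C j)] [∀ j, Module k (C j)]
  {W : Type u} [AddCommGroup W] [Module k W]

/-- **`Hom_G(⊕_j τ_j, σ) ≃ Π_j Hom_G(τ_j, σ)`** for a finite family (restriction to the summands;
inverse `(f_j) ↦ ∑_j f_j ∘ pr_j`); the first-slot companion of the tree's
`IntertwiningMap.piLinearEquiv`. [folklore] -/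
def Representation.IntertwiningMap.piLeftLinearEquiv (τ : ∀ j, Representation k G (C j))
    (σ : Representation k G W) :
    Representation.IntertwiningMap (Representation.pi τ) σ ≃ₗ[k]
      ∀ j, Representation.IntertwiningMap (τ j) σ where
  toFun f j := ⟨f.toLinearMap ∘ₗ LinearMap.single k C j, fun g => LinearMap.ext fun x => by
    change f (Pi.single j (τ j g x)) = σ g (f (Pi.single j x))
    rw [← Representation.IntertwiningMap.isIntertwining]
    congr 1
    ext j'
    rw [Representation.pi_apply_apply]
    by_cases h : j' = j
    · subst h; rw [Pi.single_eq_same, Pi.single_eq_same]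
    · rw [Pi.single_eq_of_ne h, Pi.single_eq_of_ne h, map_zero]⟩
  invFun F := ⟨∑ j, (F j).toLinearMap ∘ₗ LinearMap.proj j, fun g => LinearMap.ext fun v => by
    simp only [LinearMap.coe_comp, Function.comp_apply, LinearMap.sum_apply, map_sum]
    refine Finset.sum_congr rfl fun j _ => ?_
    change F j (Representation.pi τ g v j) = σ g (F j (v j))
    rw [Representation.pi_apply_apply, Representation.IntertwiningMap.isIntertwining]⟩
  left_inv f := Representation.IntertwiningMap.ext (LinearMap.ext fun v => by
    change (∑ j, (f.toLinearMap ∘ₗ LinearMap.single k C j) ∘ₗ LinearMap.proj j) v = f v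
    rw [LinearMap.sum_apply]
    simp only [LinearMap.coe_comp, Function.comp_apply, LinearMap.proj_apply,
      LinearMap.coe_single, Representation.IntertwiningMap.coe_toLinearMap]
    rw [← map_sum, Finset.univ_sum_single])
  right_inv F := funext fun j => Representation.IntertwiningMap.ext (LinearMap.ext fun x => by
    change ((∑ j', (F j').toLinearMap ∘ₗ LinearMap.proj j') ∘ₗ LinearMap.single k C j) x = F j x
    rw [LinearMap.comp_apply, LinearMap.sum_apply]
    simp only [LinearMap.coe_comp, Function.comp_apply, LinearMap.proj_apply,
      LinearMap.coe_single, Representation.IntertwiningMap.coe_toLinearMap]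
    rw [Finset.sum_eq_single j (fun j' _ hj' => by rw [Pi.single_eq_of_ne hj', map_zero])
      (fun h => absurd (Finset.mem_univ j) h), Pi.single_eq_same])
  map_add' _ _ := rfl
  map_smul' _ _ := rfl

/-- **Additivity of `dim Hom_G(−, σ)` over finite direct sums.** [folklore] -/
theorem Representation.finrank_intertwiningMap_pi_left [∀ j, FiniteDimensional k (C j)]
    [FiniteDimensional k W] (τ : ∀ j, Representation k G (C j)) (σ : Representation k G W) :
    Module.finrank k (Representation.IntertwiningMap (Representation.pi τ) σ) =
      ∑ j, Module.finrank k (Representation.IntertwiningMap (τ j) σ) := by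
  rw [(Representation.IntertwiningMap.piLeftLinearEquiv τ σ).finrank_eq,
    Module.finrank_pi_fintype]

end PiLeft

/-! ### Mackey's decomposition of `(coind_S^G σ)|_T` -/

section Mackey

variable {k : Type u} [Field k] {G : Type u} [Group G] (S T : Subgroup G)
  {A : Type u} [AddCommGroup A] [Module k A] (σ : Representation k S A)

/-- The conjugate subgroup `g⁻¹ S g = {x | g x g⁻¹ ∈ S}` (Mathlib `Subgroup.comap` along
`MulAut.conj g`). [folklore] -/
abbrev conjSubgroup (g : G) : Subgroup G := S.comap (MulAut.conj g).toMonoidHom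

/-- Membership in `g⁻¹ S g`. [folklore] -/
theorem mem_conjSubgroup {g x : G} : x ∈ conjSubgroup S g ↔ g * x * g⁻¹ ∈ S := Iff.rfl

/-- `[G : g⁻¹ S g] = [G : S] < ∞`. [folklore] -/
instance conjSubgroup_finiteIndex [S.FiniteIndex] (g : G) : (conjSubgroup S g).FiniteIndex :=
  ⟨by
    rw [Subgroup.index_comap_of_surjective S (f := (MulAut.conj g).toMonoidHom)
      (MulAut.conj g).surjective]
    exact Subgroup.FiniteIndex.index_ne_zero⟩

/-- Mackey's subgroup `T_g = T ∩ g⁻¹ S g`, as a subgroup of `T`. [folklore] -/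
abbrev mackeySubgroup (g : G) : Subgroup T := (conjSubgroup S g).subgroupOf T

/-- The homomorphism `T ∩ g⁻¹ S g → S`, `x ↦ g x g⁻¹`. [folklore] -/
def mackeyConjHom (g : G) : mackeySubgroup S T g →* S :=
  ((MulAut.conj g).toMonoidHom.comp (T.subtype.comp (mackeySubgroup S T g).subtype)).codRestrict
    S fun x => x.2

/-- `x ↦ g x g⁻¹` on elements. [folklore] -/
@[simp] theorem coe_mackeyConjHom_apply (g : G) (x : mackeySubgroup S T g) :
    (mackeyConjHom S T g x : G) = g * x * g⁻¹ := rfl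

/-- The conjugate representation `σ^g : x ↦ σ(g x g⁻¹)` of `T ∩ g⁻¹ S g`. [folklore] -/
abbrev mackeyConjRep (g : G) : Representation k (mackeySubgroup S T g) A :=
  σ.comp (mackeyConjHom S T g)

/-- The restriction `(coind_S^G σ)|_T`. [folklore] -/
abbrev resCoind : Representation k T (Representation.coindV S.subtype σ) :=
  (Representation.coind S.subtype σ).comp T.subtype

/-- The `T`-subrepresentation of `(coind_S^G σ)|_T` of functions supported on the double coset
`S g T`. [folklore] -/
def mackeyPiece (g : G) : Subrepresentation (resCoind S T σ) where
  toSubmodule :=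
    { carrier := {f | ∀ x, x ∉ DoubleCoset.doubleCoset g S T → f.1 x = 0}
      add_mem' := fun {f f'} hf hf' x hx => by
        change f.1 x + f'.1 x = 0
        rw [hf x hx, hf' x hx, add_zero]
      zero_mem' := fun x hx => rfl
      smul_mem' := fun c f hf x hx => by
        change c • f.1 x = 0
        rw [hf x hx, smul_zero] }
  apply_mem_toSubmodule t f hf x hx := by
    change f.1 (x * T.subtype t) = 0
    refine hf _ fun hxt => hx ?_
    obtain ⟨a, ha, b, hb, hab⟩ := DoubleCoset.mem_doubleCoset.1 hxt
    exact DoubleCoset.mem_doubleCoset.2 ⟨a, ha, b * (t : G)⁻¹, T.mul_mem hb (T.inv_mem t.2),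
      by rw [← mul_assoc, ← hab, Subgroup.coe_subtype, mul_inv_cancel_right]⟩

/-- Membership in the piece supported on `S g T`. [folklore] -/
theorem mem_mackeyPiece {g : G} {f : Representation.coindV S.subtype σ} :
    f ∈ (mackeyPiece S T σ g) ↔ ∀ x, x ∉ DoubleCoset.doubleCoset g S T → f.1 x = 0 :=
  Iff.rfl

/-- Key computation: for `f ∈ coind_S^G σ` and `F(t) := f(g t)`, if `s g t = s' g t'` then
`σ(s) F(t) = σ(s') F(t')` — in the form: `σ(s) f(g t)` only depends on `s g t`. [folklore] -/
theorem coind_apply_eq_of_eq {f : G → A}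
    (hf : ∀ (s : S) (y : G), f (s * y) = σ s (f y)) {s s' : S} {y y' : G}
    (h : (s : G) * y = s' * y') : σ s (f y) = σ s' (f y') := by
  rw [← hf, ← hf, h]

/-- The map `f ↦ (t ↦ f (g t))` from the piece supported on `S g T` to
`coind_{T ∩ g⁻¹Sg}^T σ^g`. [folklore] -/
def mackeyPieceToCoind (g : G) :
    Representation.IntertwiningMap (mackeyPiece S T σ g).toRepresentation
      (Representation.coind (mackeySubgroup S T g).subtype (mackeyConjRep S T σ g)) where
  toFun f := ⟨fun t => f.1.1 (g * t), fun x t => by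
    have hx : g * (x : T) * g⁻¹ ∈ S := x.2
    change f.1.1 (g * ((x : T) * t : T)) = σ (mackeyConjHom S T g x) (f.1.1 (g * t))
    have := f.1.2 (mackeyConjHom S T g x) (g * t)
    rw [Subgroup.coe_subtype, coe_mackeyConjHom_apply] at this
    rw [← this]
    simp only [Subgroup.coe_mul]
    group⟩
  map_add' f f' := by ext t; rfl
  map_smul' c f := by ext t; rfl
  isIntertwining' t₀ := by
    refine LinearMap.ext fun f => Subtype.ext (funext fun t => ?_)
    change f.1.1 (g * t * T.subtype t₀) = f.1.1 (g * ((t * t₀ : T) : G))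
    rw [Subgroup.coe_subtype, Subgroup.coe_mul, mul_assoc]

/-- Unfolding lemma. [folklore] -/
theorem mackeyPieceToCoind_apply (g : G) (f : (mackeyPiece S T σ g).toSubmodule) (t : T) :
    (mackeyPieceToCoind S T σ g f).1 t = f.1.1 (g * t) := rfl

variable {S T σ} in
/-- Well-definedness of the inverse map: for `F ∈ coind_{T ∩ g⁻¹Sg}^T σ^g`, the vector
`σ(s) F(t)` only depends on the product `s g t`. [folklore] -/
theorem mackey_wd (g : G)
    (F : Representation.coindV (mackeySubgroup S T g).subtype (mackeyConjRep S T σ g))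
    {s s' : S} {t t' : T} (h : (s : G) * g * t = s' * g * t') :
    σ s (F.1 t) = σ s' (F.1 t') := by
  have hx : g * ((t' * t⁻¹ : T) : G) * g⁻¹ = ((s'⁻¹ * s : S) : G) := by
    push_cast
    calc g * ((t' : G) * (t : G)⁻¹) * g⁻¹
        = (s' : G)⁻¹ * ((s' : G) * g * t') * (t : G)⁻¹ * g⁻¹ := by group
      _ = (s' : G)⁻¹ * ((s : G) * g * t) * (t : G)⁻¹ * g⁻¹ := by rw [h]
      _ = (s' : G)⁻¹ * s := by group
  let x : mackeySubgroup S T g :=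
    ⟨t' * t⁻¹, show g * ((t' * t⁻¹ : T) : G) * g⁻¹ ∈ S by rw [hx]; exact (s'⁻¹ * s).2⟩
  have hF := F.2 x t
  have hxt : (mackeySubgroup S T g).subtype x * t = t' := by
    ext
    simp [x]
  rw [hxt] at hF
  have hconj : mackeyConjHom S T g x = s'⁻¹ * s := Subtype.ext hx
  rw [hF, show mackeyConjRep S T σ g x = σ (mackeyConjHom S T g x) from rfl, hconj,
    ← Module.End.mul_apply, ← map_mul, mul_inv_cancel_left]

open Classical in
/-- The inverse map on functions: extend `F : T → A` to `S g T` by `s g t ↦ σ(s) F(t)` and by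
zero off `S g T`. [folklore] -/
def coindToMackeyPieceFun (g : G)
    (F : Representation.coindV (mackeySubgroup S T g).subtype (mackeyConjRep S T σ g)) :
    G → A := fun y =>
  if h : y ∈ DoubleCoset.doubleCoset g S T then
    σ ⟨(DoubleCoset.mem_doubleCoset.1 h).choose, (DoubleCoset.mem_doubleCoset.1 h).choose_spec.1⟩
      (F.1 ⟨(DoubleCoset.mem_doubleCoset.1 h).choose_spec.2.choose,
        (DoubleCoset.mem_doubleCoset.1 h).choose_spec.2.choose_spec.1⟩)
  else 0

/-- The extension vanishes off `S g T`. [folklore] -/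
theorem coindToMackeyPieceFun_apply_of_not_mem (g : G)
    (F : Representation.coindV (mackeySubgroup S T g).subtype (mackeyConjRep S T σ g))
    {y : G} (hy : y ∉ DoubleCoset.doubleCoset g S T) :
    coindToMackeyPieceFun S T σ g F y = 0 := by
  simp [coindToMackeyPieceFun, hy]

/-- The extension at `s g t` is `σ(s) F(t)` (well defined by `mackey_wd`). [folklore] -/
theorem coindToMackeyPieceFun_apply (g : G)
    (F : Representation.coindV (mackeySubgroup S T g).subtype (mackeyConjRep S T σ g))
    (s : S) (t : T) :
    coindToMackeyPieceFun S T σ g F (s * g * t) = σ s (F.1 t) := by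
  have h : (s : G) * g * t ∈ DoubleCoset.doubleCoset g S T :=
    DoubleCoset.mem_doubleCoset.2 ⟨s, s.2, t, t.2, rfl⟩
  rw [coindToMackeyPieceFun, dif_pos h]
  have hspec := (DoubleCoset.mem_doubleCoset.1 h).choose_spec
  have hspec2 := hspec.2.choose_spec
  exact (mackey_wd g F hspec2.2).symm

/-- `F ↦ (s g t ↦ σ(s) F(t))` lands in the piece of `coind_S^G σ` supported on `S g T`.
[folklore] -/
def coindToMackeyPiece (g : G)
    (F : Representation.coindV (mackeySubgroup S T g).subtype (mackeyConjRep S T σ g)) :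
    (mackeyPiece S T σ g).toSubmodule :=
  ⟨⟨coindToMackeyPieceFun S T σ g F, fun s y => by
    by_cases hy : y ∈ DoubleCoset.doubleCoset g S T
    · obtain ⟨a, ha, b, hb, rfl⟩ := DoubleCoset.mem_doubleCoset.1 hy
      have h1 := coindToMackeyPieceFun_apply S T σ g F ⟨a, ha⟩ ⟨b, hb⟩
      have h2 := coindToMackeyPieceFun_apply S T σ g F (s * ⟨a, ha⟩) ⟨b, hb⟩
      simp only [Subgroup.coe_mul] at h1 h2
      rw [Subgroup.coe_subtype, show (s : G) * (a * g * b) = s * a * g * b by group, h2, h1,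
        map_mul, Module.End.mul_apply]
    · have hsy : (S.subtype s) * y ∉ DoubleCoset.doubleCoset g S T := fun h => hy (by
        obtain ⟨a, ha, b, hb, hab⟩ := DoubleCoset.mem_doubleCoset.1 h
        refine DoubleCoset.mem_doubleCoset.2 ⟨s⁻¹ * a, S.mul_mem (S.inv_mem s.2) ha, b, hb, ?_⟩
        rw [Subgroup.coe_inv, mul_assoc (s : G)⁻¹, mul_assoc (s : G)⁻¹, ← hab,
          Subgroup.coe_subtype, inv_mul_cancel_left])
      rw [coindToMackeyPieceFun_apply_of_not_mem S T σ g F hy,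
        coindToMackeyPieceFun_apply_of_not_mem S T σ g F hsy, map_zero]⟩,
    fun y hy => coindToMackeyPieceFun_apply_of_not_mem S T σ g F hy⟩

/-- **Mackey, one double coset**: the piece of `(coind_S^G σ)|_T` supported on `S g T` is
`T`-equivariantly isomorphic to `coind_{T ∩ g⁻¹ S g}^T σ^g`, via `f ↦ (t ↦ f(g t))`. [folklore] -/
def mackeyPieceEquiv (g : G) :
    Representation.Equiv (mackeyPiece S T σ g).toRepresentation
      (Representation.coind (mackeySubgroup S T g).subtype (mackeyConjRep S T σ g)) :=
  Representation.Equiv.mk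
    { (mackeyPieceToCoind S T σ g).toLinearMap with
      invFun := coindToMackeyPiece S T σ g
      left_inv := fun f => by
        refine Subtype.ext (Subtype.ext (funext fun y => ?_))
        change coindToMackeyPieceFun S T σ g (mackeyPieceToCoind S T σ g f) y = f.1.1 y
        by_cases hy : y ∈ DoubleCoset.doubleCoset g S T
        · obtain ⟨a, ha, b, hb, rfl⟩ := DoubleCoset.mem_doubleCoset.1 hy
          have h1 := coindToMackeyPieceFun_apply S T σ g (mackeyPieceToCoind S T σ g f)
            ⟨a, ha⟩ ⟨b, hb⟩
          simp only at h1
          rw [h1, mackeyPieceToCoind_apply]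
          have := f.1.2 ⟨a, ha⟩ (g * b)
          rw [Subgroup.coe_subtype] at this
          rw [← this, mul_assoc]
        · rw [coindToMackeyPieceFun_apply_of_not_mem S T σ g _ hy, f.2 y hy]
      right_inv := fun F => by
        refine Subtype.ext (funext fun t => ?_)
        change coindToMackeyPieceFun S T σ g F (g * t) = F.1 t
        have h1 := coindToMackeyPieceFun_apply S T σ g F 1 t
        rw [Subgroup.coe_one, one_mul, map_one, Module.End.one_apply] at h1
        exact h1 }
    (mackeyPieceToCoind S T σ g).isIntertwining'

/-! #### The double cosets `S \ G / T` and the decomposition -/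

/-- Left multiplication by `S` preserves the double coset `S g T`. [folklore] -/
theorem subgroup_mul_mem_doubleCoset_iff {g y : G} (s : S) :
    (s : G) * y ∈ DoubleCoset.doubleCoset g S T ↔ y ∈ DoubleCoset.doubleCoset g S T := by
  constructor
  · intro h
    obtain ⟨a, ha, b, hb, hab⟩ := DoubleCoset.mem_doubleCoset.1 h
    refine DoubleCoset.mem_doubleCoset.2 ⟨s⁻¹ * a, S.mul_mem (S.inv_mem s.2) ha, b, hb, ?_⟩
    rw [Subgroup.coe_inv, mul_assoc (s : G)⁻¹, mul_assoc (s : G)⁻¹, ← hab, inv_mul_cancel_left]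
  · intro h
    obtain ⟨a, ha, b, hb, rfl⟩ := DoubleCoset.mem_doubleCoset.1 h
    exact DoubleCoset.mem_doubleCoset.2 ⟨s * a, S.mul_mem s.2 ha, b, hb, by group⟩

/-- Right multiplication by `T` preserves the double coset `S g T`. [folklore] -/
theorem mul_subgroup_mem_doubleCoset_iff {g y : G} (t : T) :
    y * t ∈ DoubleCoset.doubleCoset g S T ↔ y ∈ DoubleCoset.doubleCoset g S T := by
  constructor
  · intro h
    obtain ⟨a, ha, b, hb, hab⟩ := DoubleCoset.mem_doubleCoset.1 h
    refine DoubleCoset.mem_doubleCoset.2 ⟨a, ha, b * (t : G)⁻¹, T.mul_mem hb (T.inv_mem t.2), ?_⟩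
    rw [← mul_assoc, ← hab, mul_inv_cancel_right]
  · intro h
    obtain ⟨a, ha, b, hb, rfl⟩ := DoubleCoset.mem_doubleCoset.1 h
    exact DoubleCoset.mem_doubleCoset.2 ⟨a, ha, b * t, T.mul_mem hb t.2, by group⟩

/-- `y ∈ S g_q T` for the representative `g_q` of `q ∈ S \ G / T` iff `q` is the class of `y`
(Mathlib `DoubleCoset.mem_quotToDoubleCoset_iff`). [folklore] -/
theorem mem_doubleCoset_out_iff (q : DoubleCoset.Quotient (S : Set G) (T : Set G)) (y : G) :
    y ∈ DoubleCoset.doubleCoset q.out (S : Set G) T ↔ DoubleCoset.mk S T y = q :=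
  DoubleCoset.mem_quotToDoubleCoset_iff q y

/-- `S \ G / T` is finite when `[G : S] < ∞` (right cosets `S g` map onto double cosets
`S g T`). [folklore] -/
instance finite_doubleCosetQuotient [S.FiniteIndex] :
    Finite (DoubleCoset.Quotient (S : Set G) (T : Set G)) := by
  haveI : Finite (_root_.Quotient (QuotientGroup.rightRel S)) :=
    Finite.of_equiv _ (QuotientGroup.quotientRightRelEquivQuotientLeftRel S).symm
  refine Finite.of_surjective
    (Quotient.map' id (fun a b hab => ?_) :
      _root_.Quotient (QuotientGroup.rightRel S) → DoubleCoset.Quotient (S : Set G) (T : Set G))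
    (fun q => Quotient.inductionOn' q fun a => ⟨Quotient.mk'' a, rfl⟩)
  rw [QuotientGroup.rightRel_apply] at hab
  exact DoubleCoset.rel_iff.2 ⟨b * a⁻¹, hab, 1, T.one_mem, by simp⟩

/-- A (noncomputable) enumeration of `S \ G / T` for `[G : S] < ∞`. [folklore] -/
instance fintype_doubleCosetQuotient [S.FiniteIndex] :
    Fintype (DoubleCoset.Quotient (S : Set G) (T : Set G)) :=
  Fintype.ofFinite _

open Classical in
/-- The component of `f ∈ coind_S^G σ` on the double coset `S g T`: `f · 1_{S g T}`, a linear
map onto the piece supported on `S g T`. [folklore] -/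
def mackeyComponent (g : G) :
    Representation.coindV S.subtype σ →ₗ[k] (mackeyPiece S T σ g).toSubmodule where
  toFun f :=
    ⟨⟨fun y => if y ∈ DoubleCoset.doubleCoset g S T then f.1 y else 0, fun s y => by
        dsimp only
        by_cases hy : y ∈ DoubleCoset.doubleCoset g S T
        · have hy' : S.subtype s * y ∈ DoubleCoset.doubleCoset g S T :=
            (subgroup_mul_mem_doubleCoset_iff S T s).2 hy
          rw [if_pos hy, if_pos hy']
          exact f.2 s y
        · have hy' : S.subtype s * y ∉ DoubleCoset.doubleCoset g S T :=
            fun h => hy ((subgroup_mul_mem_doubleCoset_iff S T s).1 h)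
          rw [if_neg hy, if_neg hy', map_zero]⟩,
      fun y hy => if_neg hy⟩
  map_add' f f' := Subtype.ext (Subtype.ext (funext fun y => by
    change (if y ∈ DoubleCoset.doubleCoset g S T then f.1 y + f'.1 y else 0) =
      (if y ∈ DoubleCoset.doubleCoset g S T then f.1 y else 0) +
        (if y ∈ DoubleCoset.doubleCoset g S T then f'.1 y else 0)
    split_ifs <;> simp))
  map_smul' c f := Subtype.ext (Subtype.ext (funext fun y => by
    change (if y ∈ DoubleCoset.doubleCoset g S T then c • f.1 y else 0) =
      c • (if y ∈ DoubleCoset.doubleCoset g S T then f.1 y else 0)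
    split_ifs <;> simp))

open Classical in
/-- Unfolding lemma. [folklore] -/
theorem mackeyComponent_apply (g : G) (f : Representation.coindV S.subtype σ) (y : G) :
    (mackeyComponent S T σ g f).1.1 y =
      if y ∈ DoubleCoset.doubleCoset g S T then f.1 y else 0 := rfl

open Classical in
/-- **Mackey's decomposition**: `(coind_S^G σ)|_T = ⊕_{q ∈ S\G/T}` (functions supported on
`S g_q T`), for `[G : S] < ∞`. [folklore] -/
def mackeyDecomposition [S.FiniteIndex] :
    Representation.Equiv (resCoind S T σ)
      (Representation.pi
        (C := fun q : DoubleCoset.Quotient (S : Set G) (T : Set G) =>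
          (mackeyPiece S T σ q.out).toSubmodule)
        fun q => (mackeyPiece S T σ q.out).toRepresentation) := by
  refine Representation.Equiv.mk
    { toFun := fun f q => mackeyComponent S T σ q.out f
      map_add' := fun f f' => funext fun q => map_add _ f f'
      map_smul' := fun c f => funext fun q => map_smul _ c f
      invFun := fun F => ∑ q, ((F q).1 : Representation.coindV S.subtype σ)
      left_inv := fun f => Subtype.ext (funext fun y => by
        rw [Submodule.coe_sum, Finset.sum_apply,
          Finset.sum_eq_single (DoubleCoset.mk S T y)]
        · change (if y ∈ DoubleCoset.doubleCoset _ (S : Set G) T then f.1 y else 0) = _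
          rw [if_pos ((mem_doubleCoset_out_iff S T _ y).2 rfl)]
        · intro q _ hq
          change (if y ∈ DoubleCoset.doubleCoset _ (S : Set G) T then f.1 y else 0) = _
          rw [if_neg (fun h => hq ((mem_doubleCoset_out_iff S T q y).1 h).symm)]
        · exact fun h => absurd (Finset.mem_univ _) h)
      right_inv := fun F => funext fun q => Subtype.ext (Subtype.ext (funext fun y => by
        change (if y ∈ DoubleCoset.doubleCoset _ (S : Set G) T then
          (∑ q', ((F q').1 : Representation.coindV S.subtype σ)).1 y else 0) = _
        rw [Submodule.coe_sum, Finset.sum_apply]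
        by_cases hy : y ∈ DoubleCoset.doubleCoset q.out (S : Set G) T
        · rw [if_pos hy, Finset.sum_eq_single q]
          · intro q' _ hq'
            refine (F q').2 y fun h => hq' ?_
            rw [← (mem_doubleCoset_out_iff S T q' y).1 h, (mem_doubleCoset_out_iff S T q y).1 hy]
          · exact fun h => absurd (Finset.mem_univ _) h
        · rw [if_neg hy, (F q).2 y hy])) }
    fun t => LinearMap.ext fun f => funext fun q => Subtype.ext (Subtype.ext (funext fun y => ?_))
  change (if y ∈ DoubleCoset.doubleCoset _ (S : Set G) T then f.1 (y * T.subtype t) else 0) =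
    (if y * T.subtype t ∈ DoubleCoset.doubleCoset _ (S : Set G) T then f.1 (y * T.subtype t)
      else 0)
  by_cases hy : y ∈ DoubleCoset.doubleCoset q.out (S : Set G) T
  · have hy' : y * T.subtype t ∈ DoubleCoset.doubleCoset q.out (S : Set G) T :=
      (mul_subgroup_mem_doubleCoset_iff S T t).2 hy
    rw [if_pos hy, if_pos hy']
  · have hy' : y * T.subtype t ∉ DoubleCoset.doubleCoset q.out (S : Set G) T :=
      fun h => hy ((mul_subgroup_mem_doubleCoset_iff S T t).1 h)
    rw [if_neg hy, if_neg hy']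

/-! #### Finite-dimensionality and the intertwining numbers -/

open Classical in
/-- `coind_S^G σ` is finite-dimensional when `[G : S] < ∞` and `σ` is (through Mathlib's
`Rep.indCoindIso` and the tree's `finrank_indV_le`). [folklore] -/
instance finiteDimensional_coindV [S.FiniteIndex] [FiniteDimensional k A] :
    FiniteDimensional k (Representation.coindV S.subtype σ) := by
  haveI : S.subtype.range.FiniteIndex := by rw [Subgroup.range_subtype]; infer_instance
  haveI : FiniteDimensional k (Representation.IndV S.subtype σ) :=
    (finrank_indV_le (k := k) S.subtype σ).1
  exact LinearEquiv.finiteDimensional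
    (Representation.equivOfIso (Rep.indCoindIso (Rep.of σ))).toLinearEquiv

variable {S T σ}

/-- **Mackey's formula for `dim Hom_T(τ, (coind_S^G σ)|_T)`**:
`= ∑_{q ∈ S\G/T} dim Hom_{T ∩ g_q⁻¹ S g_q}(τ, σ^{g_q})` (Frobenius reciprocity on each piece).
[folklore] -/
theorem finrank_intertwiningMap_resCoind_right [S.FiniteIndex] [FiniteDimensional k A]
    {X : Type u} [AddCommGroup X] [Module k X] [FiniteDimensional k X]
    (τ : Representation k T X) :
    Module.finrank k (Representation.IntertwiningMap τ (resCoind S T σ)) =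
      ∑ q : DoubleCoset.Quotient (S : Set G) (T : Set G),
        Module.finrank k (Representation.IntertwiningMap
          (τ.comp (mackeySubgroup S T q.out).subtype) (mackeyConjRep S T σ q.out)) := by
  rw [show Module.finrank k (Representation.IntertwiningMap τ (resCoind S T σ)) =
      Representation.mult τ (resCoind S T σ) from rfl,
    Representation.mult_congr_right
      (W := ∀ q : DoubleCoset.Quotient (S : Set G) (T : Set G),
        (mackeyPiece S T σ q.out).toSubmodule)
      τ (mackeyDecomposition S T σ), Representation.mult_pi]
  refine Finset.sum_congr rfl fun q _ => ?_
  rw [Representation.mult_congr_right τ (mackeyPieceEquiv S T σ q.out), Representation.mult,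
    (Representation.IntertwiningMap.coindRightEquiv _ _ τ).finrank_eq]

/-- **Mackey's formula for `dim Hom_T((coind_S^G σ)|_T, τ)`**:
`= ∑_{q ∈ S\G/T} dim Hom_{T ∩ g_q⁻¹ S g_q}(σ^{g_q}, τ)` (Frobenius reciprocity for the
finite-index coinduction on each piece). [folklore] -/
theorem finrank_intertwiningMap_resCoind_left [S.FiniteIndex] [FiniteDimensional k A]
    {X : Type u} [AddCommGroup X] [Module k X] [FiniteDimensional k X]
    (τ : Representation k T X) :
    Module.finrank k (Representation.IntertwiningMap (resCoind S T σ) τ) =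
      ∑ q : DoubleCoset.Quotient (S : Set G) (T : Set G),
        Module.finrank k (Representation.IntertwiningMap (mackeyConjRep S T σ q.out)
          (τ.comp (mackeySubgroup S T q.out).subtype)) := by
  classical
  rw [(Representation.IntertwiningMap.congrLeft
      (X' := ∀ q : DoubleCoset.Quotient (S : Set G) (T : Set G),
        (mackeyPiece S T σ q.out).toSubmodule)
      (mackeyDecomposition S T σ) τ).finrank_eq,
    Representation.finrank_intertwiningMap_pi_left]
  refine Finset.sum_congr rfl fun q _ => ?_
  have h1 :=
    (Representation.IntertwiningMap.congrLeft (X := (mackeyPiece S T σ q.out).toSubmodule)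
      (X' := Representation.coindV (mackeySubgroup S T q.out).subtype (mackeyConjRep S T σ q.out))
      (mackeyPieceEquiv S T σ q.out) τ).finrank_eq
  have h2 := (Representation.IntertwiningMap.coindLeftEquiv (mackeySubgroup S T q.out)
    (mackeyConjRep S T σ q.out) τ).finrank_eq
  exact h1.trans h2

/-- **Mackey's intertwining number theorem** (the form used by Barnet-Lamb–Gee–Geraghty–Taylor
2014, § 5.5 preamble: "`(ind A, B) = (A, res B)`" and
"`res ∘ ind = ∑_{[σ] ∈ G_{F'}\G_F/G_{F''}} ind ∘ conj_σ ∘ res`"): for subgroups `S, T ≤ G` with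
`[G : S] < ∞` and finite-dimensional representations `σ` of `S`, `τ` of `T`,
`dim Hom_G(coind_S^G σ, coind_T^G τ) = ∑_{q ∈ S\G/T} dim Hom_{T ∩ g_q⁻¹Sg_q}(σ^{g_q}, τ)`,
where `σ^{g}(x) = σ(g x g⁻¹)`; for finite groups this is Ceccherini-Silberstein–Scarabotti–Tolli,
Cor. 11.4.5.
[cite: BarnetlambEtAl2014, § 5.5 preamble (arXiv:1010.2561 § 5.4, p. 39)]
[cite: CeccherinisilbersteScarabottiTolli2018, Cor. 11.4.5] -/
theorem finrank_intertwiningMap_coind_coind [S.FiniteIndex] [FiniteDimensional k A]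
    {B : Type u} [AddCommGroup B] [Module k B] [FiniteDimensional k B]
    (τ : Representation k T B) :
    Module.finrank k (Representation.IntertwiningMap (Representation.coind S.subtype σ)
        (Representation.coind T.subtype τ)) =
      ∑ q : DoubleCoset.Quotient (S : Set G) (T : Set G),
        Module.finrank k (Representation.IntertwiningMap (mackeyConjRep S T σ q.out)
          (τ.comp (mackeySubgroup S T q.out).subtype)) := by
  rw [(Representation.IntertwiningMap.coindRightEquiv T.subtype τ
      (Representation.coind S.subtype σ)).finrank_eq]
  exact finrank_intertwiningMap_resCoind_left τ

end Mackey

end Literature.RepresentationTheory.FiniteGroups
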